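import Summits.Ventures.DiscreteObjects.Hadamard.FixedSubmatrix23

/-!
# Hadamard 668 census, family F12 — order 7: never exactly 10 fixed rows (the 94-class case is excluded at matrix level)

Framing: lottery ticket; floor = certified bounds/negative ranges.

Cell pub-namedobj (venture DiscreteObjects), target (H), hadamard gen 16.  The kernel window for a signed automorphism of
order `7` of an H(668) is `84 ≤ m ≤ 94` classes of moved columns (`hadamard668_signedAut_colClasses_window`), i.e.
`f = 668 − 7m ∈ {10, 24, 38, 52, 66, 80}` fixed columns.  FAMILY-F12-G5 §9 excluded `m = 94` at the DESIGN level by the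
fixed-pair arithmetic (`no_fixedPair667`, p231752: `(7, 9)`); this file transfers it to the matrix:
**`hadamard668_fixedRows_7_ne_10`** — a signed automorphism `(π, κ, d, e)` of a Hadamard matrix of order `668` with
`π⁷ = κ⁷ = 1`, `(π, κ) ≠ (1, 1)` never fixes exactly `10` columns, nor exactly `10` rows.  Design-level core (`side7_ne_nine`):
in the normalised `2-(667,333,166)` structure an automorphism pair `(ρ, τ)` of exponent `7` cannot have exactly `9` fixed
blocks — two `ρ`-fixed points exist (`#Fix ρ ≡ 667 ≡ 2 (mod 7)`), each lies on `c ≡ 333 ≡ 4 (mod 7)` fixed blocks, so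
`c = 4 ≤ 9`, and two of them share `u ≡ 166 ≡ 5 (mod 7)` fixed blocks with `u ≤ c = 4`: impossible.  Used by the rank-2
census (FAMILY-F12-G16 §2(d)): with `f ≠ 10` the summed orbit identities exclude `C₇ × C₇` (two exact implementations).
Ours, not literature; no `sorry`.
-/

open Finset BigOperators

namespace Summit.Ventures.DiscreteObjects.Hadamard

open Literature.Combinatorics.Designs.GoethalsSeidel (IsHadamardMatrix)

section design
variable {P B : Type*} [Fintype P] [DecidableEq P] [Fintype B] [DecidableEq B]

/-- **design level: an automorphism pair of exponent 7 of a `2-(667,333,166)` structure has not exactly 9 fixed blocks** -/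
lemma side7_ne_nine (N : P → B → ℤ) (h01 : ∀ x y, N x y = 0 ∨ N x y = 1)
    (hrow : ∀ x, ∑ y, N x y = 333) (hpair : ∀ x x', x ≠ x' → ∑ y, N x y * N x' y = 166)
    (hP : Fintype.card P = 667)
    (ρ : Equiv.Perm P) (τ : Equiv.Perm B) (hN : ∀ x y, N (ρ x) (τ y) = N x y)
    (hρ : ρ ^ 7 = 1) (hτ : τ ^ 7 = 1) :
    (univ.filter fun y => τ y = y).card ≠ 9 := by
  intro hF
  have hp : (7 : ℕ).Prime := by norm_num
  -- two distinct ρ-fixed points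
  have hmod := card_fixed_mod ρ hp hρ
  rw [hP] at hmod
  have h2 : 1 < (univ.filter fun x => ρ x = x).card := by omega
  obtain ⟨x, hx, x', hx', hxx'⟩ := Finset.one_lt_card.mp h2
  have hxρ : ρ x = x := (Finset.mem_filter.mp hx).2
  have hx'ρ : ρ x' = x' := (Finset.mem_filter.mp hx').2
  obtain ⟨a, ha⟩ := fixedPoint_row N hrow hp ρ τ hN hτ hxρ
  obtain ⟨c0, c1⟩ := fixedCount_bounds N h01 τ x
  obtain ⟨t, ht⟩ := fixedPair N hp ρ τ hN hτ hxρ hx'ρ (hpair x x' hxx')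
  obtain ⟨u0, u1⟩ := pairCount_bounds N h01 τ x x'
  rw [hF] at c1
  push_cast at ha c1 ht
  omega

end design

variable {ι : Type*} [Fintype ι] [DecidableEq ι]

/-- **Order 7: never exactly 10 fixed columns, never exactly 10 fixed rows** (so the class number `m = 94` of the kernel
window `84 ≤ m ≤ 94` does not occur). -/
theorem hadamard668_fixedRows_7_ne_10 {H : Matrix ι ι ℤ} (hH : IsHadamardMatrix H) (hι : Fintype.card ι = 668)
    (π κ : Equiv.Perm ι) (d e : ι → ℤ) (haut : IsSignedAut H π κ d e)
    (hπ : π ^ 7 = 1) (hκ : κ ^ 7 = 1) (hne : π ≠ 1 ∨ κ ≠ 1) :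
    (univ.filter fun j => κ j = j).card ≠ 10 ∧ (univ.filter fun i => π i = i).card ≠ 10 := by
  have hcard : (Fintype.card ι : ℤ) ≠ 0 := by rw [hι]; norm_num
  have hodd : Odd 7 := by decide
  have hπ1 : π ≠ 1 := by
    rcases hne with h | h
    · exact h
    · intro hπ1
      apply h
      rw [hπ1] at haut
      exact signedAut_snd_eq_one H hH hcard haut hodd hκ
  have hnd : ¬ 7 ∣ Fintype.card ι := by rw [hι]; norm_num
  haveI : Fact (7 : ℕ).Prime := ⟨by norm_num⟩
  obtain ⟨r, hr⟩ := Equiv.Perm.exists_fixed_point_of_prime (n := 1) hnd (σ := π) (by rw [pow_one]; exact hπ)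
  obtain ⟨c, hc⟩ := Equiv.Perm.exists_fixed_point_of_prime (n := 1) hnd (σ := κ) (by rw [pow_one]; exact hκ)
  obtain ⟨hπr, hκc, h01, hrow, hpair, hcol, hcpair, hP, hB, hN, hρ, hτ, x₀, hx₀⟩ :=
    transfer668 hH hι 7 π κ d e haut hπ hκ hπ1 hr hc
  -- blocks side and (dually) points side
  have hBside := side7_ne_nine (fun (x : {i // i ≠ r}) (y : {j // j ≠ c}) => inc H r c x.1 y.1) h01 hrow hpair hP
    (π.subtypePerm hπr) (κ.subtypePerm hκc) hN hρ hτ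
  have hPside := side7_ne_nine (fun (y : {j // j ≠ c}) (x : {i // i ≠ r}) => inc H r c x.1 y.1) (fun y x => h01 x y)
    hcol hcpair hB (κ.subtypePerm hκc) (π.subtypePerm hπr) (fun y x => hN x y) hτ hρ
  rw [card_fixed_eq_succ π r hr hπr, card_fixed_eq_succ κ c hc hκc]
  omega

end Summit.Ventures.DiscreteObjects.Hadamard
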